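import Summits.ABC.ABC.Theses.IsogenyGlueCongruence
import Summits.ABC.ABC.Theorems.IsogenyGlueCongruencePolyHeightOfBoundedPrimes
import Summits.ABC.ABC.Theorems.PolyHeightOfBoundedPrimes.Negative.FalseWithoutMinimality
import Summits.ABC.ABC.Theorems.PolyHeightOfBoundedPrimes.Negative.ExponentFloor
import Summits.ABC.ABC.Theorems.PolyHeightOfBoundedPrimes.Negative.AbstractHypothesisVoid
import Summits.ABC.ABC.Theorems.PolyHeightOfBoundedPrimes.Negative.ArchimedeanFloor
import Summits.ABC.ABC.Theorems.PolyHeightOfBoundedPrimes.Negative.HallHalfFloor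
import Summits.ABC.ABC.Theorems.PolyHeightOfBoundedPrimes.Negative.DeltaHalfFloor
import Summits.ABC.ABC.Theorems.PolyHeightOfBoundedPrimes.Negative.SplitBookkeeping

/-!
# Disproof of `PolyHeightOfBoundedPrimes` — findings (crux B', stmt-ABC-16006, route IsogenyGlueCongruence)

Standing-adversary work file of the cdisprove seat `refuter-cdisprove-stmt-ABC-16006-0` (gen 1, cycle 1,
2026-08-16). Prose only in docstrings. SORRY-FREE (v2). Read with the landed negatives it cites:
`Theorems/PolyHeightOfBoundedPrimes/Negative/FalseWithoutMinimality` (p117793), `…/ExponentFloor`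
(p117988) [rattack seat]; `…/AbstractHypothesisVoid` (p121244), `…/ArchimedeanFloor` (p121348),
`…/HallHalfFloor` (p121660), `…/DeltaHalfFloor` (p121766), `…/SplitBookkeeping` (p122124:
`H → PolySzpiroΔ ∧ PolyHallΔ`, the split is exact) [THIS seat, cycle 1]; `Theorems/PolyDegreeOfBoundedPrimes/Negative/AbstractStrengtheningFalse` (p82575) and
the sibling work file `Cruxes/PolyDegreeOfBoundedPrimes/Disproof.lean` (crux B; B → B').

* §0 SHAPE. `B' = (A → H)`: `A = DegreePrimesPolyBounded` (every prime factor of the modular degree of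
  a semistable globally-minimal elliptic `W/ℚ` is `≤ C·N^κ`, `∃ D` form), `H` = the polynomial height
  conjecture for semistable curves (`max(|Δ_W|,|c₄(W)|³) ≤ C·N_W^σ`, exponent free; Frey 1989 =
  Pasten–Shimura 2024 Conj 3.1 on semistable curves). `iff_imp`, `of_H`, `of_not_A`, `iff_H_of_A`:
  B' is `H` as soon as A holds and is TRUE as soon as A fails — its truth value is `¬A ∨ H`.
* §1 WHY IT RESISTS (kernel-checked anatomy of a refutation). `not_iff : ¬B' ↔ A ∧ ¬H`; a refuter of
  B' must therefore (i) PROVE crux A — in particular construct a `ModularParametrizationData` for every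
  semistable global minimal elliptic `W/ℚ` (`nonempty_parametrization_of_not`: semistable modularity
  with integral Manin constant + complex uniformisation, of which the tree holds no closed term) and
  (ii) REFUTE polynomial Szpiro for semistable curves, hence refute the summit (`not_ABC_of_not`, via
  the landed `of_ABC`), the Bombieri–Gubler generalized Szpiro conjecture (`not_generalizedSzpiroBG_of_not`),
  the route target X (`not_target_of_not`) and crux B (`not_B_of_not`). VERDICT (cycle 1): not
  refutable in this tree for reasons independent of its truth; expected TRUE because `ABC → B'`.
* §2 LOAD-BEARING ANALYSIS of the binders of `H` (A is a hypothesis of the implication, see §2c).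
  (a) `[W.IsGloballyMinimal]`: LOAD-BEARING — landed `not_polyHeight_without_isGloballyMinimal`
  (rescaled Frey curve `(1/m,0,0,0) • freyCurve 3 32`, `|Δ| = m¹²|Δ₀|`, `N` fixed), re-exported as
  `polyHeight_false_without_isGloballyMinimal`; (b) `W.IsSemistable ℤ`: NOT load-bearing for truth
  (landed `polyHeight_without_isSemistable_of_generalizedSzpiroBG`), it only restricts the claim;
  (c) `[NeZero (W.conductorNorm ℤ)]`: pure DECORATION — `H_iff_noNeZero` (the instance is automatic,
  `conductorNorm_pos_holds`; it is needed only to TYPE `A`, whose datum lives at level `N_W`);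
  (d) `[W.IsElliptic]`: needed for meaning (for singular `W` all of `Δ`, `N_W`, semistability are junk;
  not formalisable as a counterexample since `W.minimal` is a choice) — paper remark;
  (e) THE HYPOTHESIS A IS IDLE IN THE ABSTRACT: `abstract_iff_H` — replace "modular degree" in A by an
  ARBITRARY positive-integer invariant `d(W)` and the strengthened item is exactly `H` (witness
  `d ≡ 1`); `calibrated_iff_H` — even demanding that `d(W)` DOMINATE any prescribed function `g` of the
  height quantity `max(|Δ|,|c₄|³)` (the Zagier–Silverman calibration `deg φ/c² ≫ max^{1/6}` is such a
  `g`), the item is still exactly `H` (witness `d = 2^{g}`: one prime, `2 ≤ 2·N⁰`, unbounded DEPTH).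
  So prime SIZES of a height-calibrated integer carry no information; what a proof of B' must bound is
  the total CONTACT `Σ_ℓ v_ℓ(deg φ/c²)·log ℓ` against `log N` — depth × multiplicity of the congruence
  primes — using that `deg φ` is a modular degree (Ribet/ARS `m_E = r_E` at squarefree level, Hida's
  congruence-module/adjoint-Selmer reading; sibling Disproof §7). This is B's `not_abstractPolyOfBoundedPrimes`
  (`2ⁿ`) and `…_squarefree` (`n#`) read on B': there the abstract form was FALSE, here it is `↔ H`
  because B' never mentions the size of `deg φ` — A can only enter through the landed calibration
  `polyHeightOfBoundedPrimes_iff_polyDegreeUpToManin` (deg/c² form, RewirePolyDegreeManinRelative).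
* §3 TIGHTNESS / FLOORS. Landed: any witness `(σ, C)` of `H` has `σ > 6`, `C > 0` (Masser 1990,
  `exists_six_lt_of_polyHeightOfBoundedPrimes`, `polyHeightOfBoundedPrimes_exp_le_six_iff_not_…`).
  New here: `H_iff_naive` — `H` is equivalent to its NAIVE-HEIGHT form `max(|c₄|³, c₆²) ≤ C·N^σ`
  (`1728Δ = c₄³ − c₆²`), and `not_naiveHeightAt_of_le_six` — that form has the same floor `σ > 6`;
  both components of Pasten's `h = (1/12) log max(|c₄³|,|c₆²|)` are therefore in play only above 6.
  SPLIT FLOORS (card archimedean-hall-split, all landed this cycle): Δ-half `|Δ| ≤ C·N^σ` false for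
  `σ ≤ 6`, any `C` (`not_polySzpiroΔAt_of_le_six`, p121766); `c₄`-component `|c₄|³ ≤ C·N^σ` false
  for `σ < 6` (`not_polyC4At_of_lt_six`, p121348, §7); Hall half `|c₄|³ ≤ C·|Δ|^{σ'}` false for
  `0 ≤ σ' < 3/2` (`not_polyHallAt_of_lt_three_halves`, p121660, §7b).
* §4 NATURAL STRENGTHENINGS refuted or neutralised: fixed exponent `σ ≤ 6` (landed, `↔ ¬A`); model
  gauge dropped (landed, `↔ ¬A`); abstract / calibrated-abstract hypothesis (§2e, `↔ H`: no free
  lunch, no kill); B-type abstract size statements (`2ⁿ`, `n#`, landed p82575).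
* §5 TARGETS (lead's stuck stubs): none assigned (payload.targets = [] at cycle 1; no line picked).
* §6 CENSUS — RESULTS (kit job j019489, PARI 2.15.4 `ellmoddegree` = deg φ/c², cmp-1, 3.3 min on 4
  cores; evidence `compute-j019489.json`, `outputs/summary.txt`, `census.csv` on the item). Population:
  the 3976 coprime triples `a + b = c ≤ 10⁷` with `rad(abc) ≤ 2·10⁴`; 913 Frey curves computed (per
  rad-band: top Szpiro ratios `σ_Δ = log|Δ_min|/log N`, top height ratios `σ_h = log max(|Δ_min|,
  |c₄|³)/log N`, top quality, random controls), 478 SEMISTABLE (`N` squarefree, `15 ≤ N ≤ 19686`),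
  0 timeouts (cost: 0.05 s at `N < 2000`, 1.7 s at `N ≈ 1.9·10⁴`, ≤ 9 s at `N ≈ 3·10⁵`). NUMBERS
  (semistable rows): (i) CALIBRATION `α := log(deg/c²)/log N` against `σ_h`: Pearson `r = 0.957`
  (`N ≥ 3000`, n = 230); least squares `α ≈ 0.42 + 0.150·σ_h` (n = 333, `N ≥ 10³`; Zagier–Silverman
  predict slope `1/6`); `α_max = 1.848` (`N = 14070`, `1701 + 1046875 = 2²⁰`, `σ_h = 8.71`,
  `deg/c² = 2¹⁶·3·5·47`); largest Szpiro ratio in range `σ_Δ = 7.26` (`N = 2730`, `7168 + 78125 =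
  85293`, `deg/c² = 2¹³·3·5·7`). (ii) PRIME SIZES: `β := log ℓ_max/log N ≤ 0.767` over ALL 478
  (`N = 5159`: `2⁵·3·5·701`); no `ℓ > N` anywhere; mean `β` by `σ_h`-bin `[<4 | 4–6 | 6–7 | 7–8 | 8–10]`
  = `0.17 | 0.22 | 0.25 | 0.27 | 0.29` while mean `α` = `0.95 | 1.2 | 1.39 | 1.52 | 1.71`;
  `r(σ_h, β) = 0.25` against `r(σ_h, α) = 0.96`. (iii) DEPTH: share of `log(deg/c²)` carried by
  `ℓ ≤ 7` = `0.92 | 0.92 | 0.89 | 0.88 | 0.87` (by `ℓ = 2` alone `0.77 → 0.53`); 217 of the 333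
  semistable curves with `N ≥ 10³` have 7-SMOOTH `deg/c²` (35 of the 67 with `σ_h ≥ 7`); median
  `ℓ_max = 7` for `σ_h ∈ [6,8)`, `11` for `σ_h ≥ 8`; `v₂(deg/c²) − ω(N)` rises `+3.5 → +6.6` and the
  depth excess `Σ(e_ℓ−1) log ℓ/log N` `0.57 → 1.01` from the lowest to the highest bin; e.g.
  `N = 4290` (`121 + 255879 = 256000`, `σ_h = 8.93`): `deg/c² = 2¹²·3⁴·7`; `N = 4830` (`128 + 109375
  = 109503`): `2¹²·3⁵`; `N = 1218` (`343 + 59049 = 59392`, `σ_h = 9.28`): `2⁸·3³·5·7`. READING FOR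
  B': on the Szpiro-extremal Frey family crux A holds with `κ = 1`, `C = 1` and a wide margin
  UNIFORMLY in the height, while the height excess `log(deg/c²) − log N` (`≈ 12h_F − log N + O(1)`)
  is carried by DEPTH at `ℓ ∈ {2,3,5,7}` — level-lowering at the exponents of the smooth triple
  (`ℓ^k ∣ v_p(Δ_min) ⟹ ℓ^k ∣ deg φ`, Tate + Ribet) plus the 2-isogeny/Atkin–Lehner 2-part — not by
  large congruence primes: prime SIZES are statistically blind to height here, the data face of
  `abstract_iff_H`/`calibrated_iff_H` (§2e). CAVEATS: Frey family only (full rational 2-torsion,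
  smooth exponents by construction — the sibling census j014003 of generic small-height semistable
  curves had squarefree odd part for 84 %); `deg/c²` is that of the Frey model (a bounded 2-power from
  the isogeny to the optimal curve is included); `N ≤ 2·10⁴`. PENDING: census-2 (kit j019767, same
  design, `rad ≤ 3·10⁵`, all triples below `2·10⁴`) and the Hall-regime census (kit j019589:
  `|X³ − Y²| < X/2`, `X ≤ 2·10⁸`, plus verified known Hall near-misses — the ARCHIMEDEAN side of `H`,
  semistable excursions `|c₄| ≫ |Δ|`, class numbers of `ℚ(√(−3Δ))` as a falsifier of card
  mordell-twist-cm-height's 3-descent dichotomy, and `deg/c²` there).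
* §7 ARCHIMEDEAN FLOOR (landed p121348) and NEAR-MISSES (none sorried). `not_polyC4At_of_lt_six`:
  the ARCHIMEDEAN component alone, `∃ C, ∀ W, |c₄|³ ≤ C·N^σ`, is FALSE for every `σ < 6` (Masser-type
  Frey pairs `exists_frey_pair_excess` have `Δ > 0`, so `|c₄|³ ≥ c₄³ = c₆² + 1728Δ ≥ 1728|Δ_min| ≥ N⁶`;
  sign-carrying transport `exists_globallyMinimal_model_pos`); `six_le_of_polyC4At`. So in the split
  of card archimedean-hall-split BOTH halves live at exponent `≥ 6` in `N`. Open residue: `σ = 6`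
  with an arbitrary constant for the `c₄`-component (needs Masser's polylog excess with the sign of
  `Δ` exported; the `Δ`-component has it, `not_polyHeightAt_of_le_six`). Not attempted: the Hall
  half below `σ' = 6` (Danilov's Fermat–Pell family realised by SEMISTABLE curves needs Tate's
  algorithm at 2 and 3 on that family).
* §7b HALL-HALF FLOOR (landed p121660). `not_polyHallAt_of_lt_three_halves`: the Hall half
  `∃ C, ∀ W, |c₄|³ ≤ C·|Δ_W|^{σ'}` of card archimedean-hall-split is FALSE for every `0 ≤ σ' < 3/2`,
  already on the Frey family `y² = x(x+1)(x+32k)` (global minimal model: `|c₄|³ = (1−b+b²)³`,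
  `|Δ_min| = (b(b−1))²/2⁸`, `b = 32k`); `three_halves_le_of_polyHallAt`. Frey curves see exactly
  `σ' = 3/2`; the conjectural floor `6` (Danilov) needs non-Frey families — the Hall-regime census
  (kit j019589) lists the semistable excursions `|c₄| ≫ |Δ|` it finds with `X ≤ 2·10⁸` plus the
  verified known large Hall near-misses (Elkies-type table, re-verified inside the job).
-/

noncomputable section

-- `Summit.<Summit>.<Problem>`: for the single-conjunct summit `ABC` the duplicate `ABC.ABC` is mandated.
set_option linter.dupNamespace false

namespace Summit.ABC.ABC.Cruxes.PolyHeightOfBoundedPrimes.Disproof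

open Summit.ABC.ABC.Theses.IsogenyGlueCongruence
open Literature.NumberTheory.EllipticCurves.ModularForms (ModularParametrizationData)
open Literature.NumberTheory.EllipticCurves (GeneralizedSzpiroConjectureBG)
open WeierstrassCurve

/-! ## §0 Shape: `B' = (A → H)` -/

/-- `H`: the polynomial height conjecture for semistable elliptic curves over `ℚ` in global minimal
form — verbatim the consequent of the item. [cite: PastenShimura2024, Conj. 3.1] -/
def H : Prop :=
  ∃ σ C : ℝ, ∀ (W : WeierstrassCurve ℚ) [W.IsElliptic] [W.IsGloballyMinimal]
    [NeZero (W.conductorNorm ℤ)], W.IsSemistable ℤ →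
      ((max |W.Δ| (|W.c₄| ^ 3) : ℚ) : ℝ) ≤ C * (W.conductorNorm ℤ : ℝ) ^ σ

/-- The item is literally `A → H`. [folklore] -/
theorem iff_imp : PolyHeightOfBoundedPrimes ↔ (DegreePrimesPolyBounded → H) := Iff.rfl

/-- `H` closes the item (A idle). [folklore] -/
theorem of_H (h : H) : PolyHeightOfBoundedPrimes := fun _ ↦ h

/-- `¬A` closes the item vacuously. [folklore] -/
theorem of_not_A (h : ¬ DegreePrimesPolyBounded) : PolyHeightOfBoundedPrimes := fun hA ↦ (h hA).elim

/-- Granted A, the item IS `H`. [folklore] -/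
theorem iff_H_of_A (hA : DegreePrimesPolyBounded) : PolyHeightOfBoundedPrimes ↔ H :=
  ⟨fun h ↦ h hA, fun h _ ↦ h⟩

/-! ## §1 Why it resists: anatomy of a refutation -/

/-- A refutation of B' is exactly a proof of A together with a refutation of H. [folklore] -/
theorem not_iff : ¬ PolyHeightOfBoundedPrimes ↔ (DegreePrimesPolyBounded ∧ ¬ H) := by
  constructor
  · intro h
    refine ⟨?_, fun hH ↦ h (of_H hH)⟩
    by_contra hA
    exact h (of_not_A hA)
  · rintro ⟨hA, hH⟩ h
    exact hH (h hA)

/-- … in particular it proves crux A. [folklore] -/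
theorem A_of_not (h : ¬ PolyHeightOfBoundedPrimes) : DegreePrimesPolyBounded := (not_iff.mp h).1

/-- … and refutes the polynomial height conjecture for semistable curves. [folklore] -/
theorem not_H_of_not (h : ¬ PolyHeightOfBoundedPrimes) : ¬ H := (not_iff.mp h).2

/-- … hence exhibits semistable MODULARITY data (integral Manin constant, complex uniformisation) for
every semistable globally minimal elliptic curve over `ℚ` — a closed term the tree does not hold
(`nonempty_modularParametrizationData` is an undischarged named fact). [cite: BCDTJAMS2001, Thm. A] -/
theorem nonempty_parametrization_of_not (h : ¬ PolyHeightOfBoundedPrimes) (W : WeierstrassCurve ℚ)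
    [W.IsElliptic] [W.IsGloballyMinimal] [NeZero (W.conductorNorm ℤ)] (hW : W.IsSemistable ℤ) :
    Nonempty (ModularParametrizationData W (W.conductorNorm ℤ)) := by
  obtain ⟨κ, C, hA⟩ := A_of_not h
  obtain ⟨D, -⟩ := hA W hW
  exact ⟨D⟩

/-- … and refutes the summit `ABC` (landed closer `of_ABC`, Bombieri–Gubler Thm 12.5.12).
[cite: BombieriGubler2006, Thm. 12.5.12] -/
theorem not_ABC_of_not (h : ¬ PolyHeightOfBoundedPrimes) : ¬ ABC :=
  fun hABC ↦ h (Summit.ABC.ABC.Theorems.PolyHeightOfBoundedPrimes.of_ABC hABC)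

/-- … and the Bombieri–Gubler generalized Szpiro conjecture. [cite: BombieriGubler2006, Conj. 12.5.11 (p. 431)] -/
theorem not_generalizedSzpiroBG_of_not (h : ¬ PolyHeightOfBoundedPrimes) :
    ¬ GeneralizedSzpiroConjectureBG :=
  fun hG ↦ h (Summit.ABC.ABC.Theorems.PolyHeightOfBoundedPrimes.of_generalizedSzpiroBG hG)

/-- … and the route target X. [folklore] -/
theorem not_target_of_not (h : ¬ PolyHeightOfBoundedPrimes) : ¬ SemistableDegreeConjecture :=
  fun hX ↦ h (Summit.ABC.ABC.Theorems.PolyHeightOfBoundedPrimes.of_semistableDegreeConjecture hX)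

/-- … and crux B (B → B' unconditionally, p102896). [folklore] -/
theorem not_B_of_not (h : ¬ PolyHeightOfBoundedPrimes) : ¬ PolyDegreeOfBoundedPrimes :=
  fun hB ↦ h (Summit.ABC.ABC.Theorems.PolyHeightOfBoundedPrimes.of_polyDegreeOfBoundedPrimes hB)

/-! ## §2 Load-bearing analysis of the binders of `H` -/

/-- (a) `[W.IsGloballyMinimal]` is load-bearing: the model-gauge-free form of `H` is FALSE
(landed, p117793; rescaled Frey curves). Re-export. [folklore] -/
theorem polyHeight_false_without_isGloballyMinimal :
    ¬ (∃ σ C : ℝ, ∀ (W : WeierstrassCurve ℚ) [W.IsElliptic] [NeZero (W.conductorNorm ℤ)],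
      W.IsSemistable ℤ → ((max |W.Δ| (|W.c₄| ^ 3) : ℚ) : ℝ) ≤ C * (W.conductorNorm ℤ : ℝ) ^ σ) :=
  Summit.ABC.ABC.Theorems.PolyHeightOfBoundedPrimes.Negative.not_polyHeight_without_isGloballyMinimal

/-- `H` with the binder `[NeZero (W.conductorNorm ℤ)]` removed. [folklore] -/
def HNoNeZero : Prop :=
  ∃ σ C : ℝ, ∀ (W : WeierstrassCurve ℚ) [W.IsElliptic] [W.IsGloballyMinimal], W.IsSemistable ℤ →
    ((max |W.Δ| (|W.c₄| ^ 3) : ℚ) : ℝ) ≤ C * (W.conductorNorm ℤ : ℝ) ^ σ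

/-- (c) `[NeZero (W.conductorNorm ℤ)]` is decoration: `N_W ≥ 1` for every elliptic `W/ℚ`
(`conductorNorm_pos_holds`), so `H` is equivalent to the form without that binder; the binder only
serves to type `A` (the datum `ModularParametrizationData W N_W` needs `[NeZero N_W]`). [folklore] -/
theorem H_iff_noNeZero : H ↔ HNoNeZero := by
  constructor
  · rintro ⟨σ, C, h⟩
    refine ⟨σ, C, fun W _ _ hW ↦ ?_⟩
    haveI : NeZero (W.conductorNorm ℤ) := ⟨(W.conductorNorm_pos_holds).ne'⟩
    exact h W hW
  · rintro ⟨σ, C, h⟩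
    exact ⟨σ, C, fun W _ _ _ hW ↦ h W hW⟩

/-- The hypothesis of the item with "the modular degree of some datum of `W`" replaced by an
arbitrary integer invariant `d(W)`: all prime factors of `d(W)` are `≤ C·N_W^κ`. [folklore] -/
def AbstractHyp (d : WeierstrassCurve ℚ → ℕ) : Prop :=
  ∃ κ C : ℝ, ∀ (W : WeierstrassCurve ℚ) [W.IsElliptic] [W.IsGloballyMinimal]
    [NeZero (W.conductorNorm ℤ)], W.IsSemistable ℤ →
      ∀ ℓ : ℕ, ℓ.Prime → ℓ ∣ d W → (ℓ : ℝ) ≤ C * (W.conductorNorm ℤ : ℝ) ^ κ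

/-- (e₁) ABSTRACT form of B': for EVERY positive-integer invariant `d` with polynomially bounded
prime factors, `H`. [folklore] -/
def AbstractPolyHeightOfBoundedPrimes : Prop :=
  ∀ d : WeierstrassCurve ℚ → ℕ, (∀ W, 0 < d W) → AbstractHyp d → H

/-- The constant invariant `d ≡ 1` has no prime factor at all. [folklore] -/
theorem abstractHyp_one : AbstractHyp (fun _ ↦ 1) :=
  ⟨0, 0, fun _ _ _ _ _ _ hℓ hdvd ↦ absurd (Nat.le_of_dvd one_pos hdvd) (not_le.mpr hℓ.one_lt)⟩

/-- **(e₁) The abstract form of B' is exactly `H`**: forgetting that `deg φ` is a modular degree,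
the hypothesis "some positive integer attached to `W` has only small prime factors" is void
(`d ≡ 1`). Contrast crux B, whose abstract form is FALSE (`not_abstractPolyOfBoundedPrimes`, `2ⁿ`):
B' never mentions the SIZE of `deg φ`, so A can act only through the calibration `deg φ/c² ≍ e^{12h}`
(Zagier + Silverman, landed). [folklore] -/
theorem abstract_iff_H : AbstractPolyHeightOfBoundedPrimes ↔ H :=
  ⟨fun h ↦ h _ (fun _ ↦ one_pos) abstractHyp_one, fun hH _ _ _ ↦ hH⟩

/-- (e₂) CALIBRATED abstract form: the invariant `d(W)` is moreover required to dominate a prescribed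
function `g` of the height quantity `max(|Δ_W|, |c₄(W)|³)` (any growth whatsoever). [folklore] -/
def CalibratedAbstractPolyHeightOfBoundedPrimes (g : ℚ → ℕ) : Prop :=
  ∀ d : WeierstrassCurve ℚ → ℕ, (∀ W : WeierstrassCurve ℚ, g (max |W.Δ| (|W.c₄| ^ 3)) ≤ d W) →
    (∀ W, 0 < d W) → AbstractHyp d → H

/-- Powers of two have the single prime factor `2 ≤ 2·N⁰`. [folklore] -/
theorem abstractHyp_two_pow (e : WeierstrassCurve ℚ → ℕ) : AbstractHyp (fun W ↦ 2 ^ e W) := by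
  refine ⟨0, 2, fun W _ _ _ _ ℓ hℓ hdvd ↦ ?_⟩
  have h2 : ℓ = 2 := (Nat.prime_dvd_prime_iff_eq hℓ Nat.prime_two).mp (hℓ.dvd_of_dvd_pow hdvd)
  subst h2
  simp

/-- **(e₂) Even calibrated, the abstract form of B' is exactly `H`** (witness `d = 2^{g(·)}`: it
dominates `g`, has one prime factor, and unbounded 2-adic DEPTH). So no argument of the shape
"`deg φ/c²` is large (calibration) and has only small prime factors (A), hence …" can prove B': the
quantity a proof must control is the total contact `Σ_ℓ v_ℓ(deg φ/c²) log ℓ` versus `log N`, i.e.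
DEPTH × MULTIPLICITY of the congruence primes, through arithmetic special to modular degrees.
[folklore] -/
theorem calibrated_iff_H (g : ℚ → ℕ) : CalibratedAbstractPolyHeightOfBoundedPrimes g ↔ H := by
  refine ⟨fun h ↦ h (fun W ↦ 2 ^ g (max |W.Δ| (|W.c₄| ^ 3))) (fun W ↦ ?_) (fun W ↦ Nat.two_pow_pos _)
    (abstractHyp_two_pow _), fun hH _ _ _ _ ↦ hH⟩
  exact (Nat.lt_two_pow_self).le

/-! ## §3 Tightness / floors of the consequent -/

/-- Granted A, any witness of B' has `σ > 6` and `C > 0` (landed, p117988; Masser 1990). Re-export.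
[cite: Masser1990, Theorem and Lemma 1] -/
theorem exists_six_lt (hB' : PolyHeightOfBoundedPrimes) (hA : DegreePrimesPolyBounded) :
    ∃ σ C : ℝ, 6 < σ ∧ 0 < C ∧
      ∀ (W : WeierstrassCurve ℚ) [W.IsElliptic] [W.IsGloballyMinimal]
        [NeZero (W.conductorNorm ℤ)], W.IsSemistable ℤ →
        ((max |W.Δ| (|W.c₄| ^ 3) : ℚ) : ℝ) ≤ C * (W.conductorNorm ℤ : ℝ) ^ σ :=
  Summit.ABC.ABC.Theorems.PolyHeightOfBoundedPrimes.Negative.exists_six_lt_of_polyHeightOfBoundedPrimes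
    hB' hA

/-- The NAIVE-HEIGHT form of `H`: `max(|c₄|³, c₆²) ≤ C·N^σ` (Pasten's `h(E) = (1/12) log max(|c₄³|, |c₆²|)`
for a minimal model). [cite: PastenShimura2024, §3] -/
def HNaive : Prop :=
  ∃ σ C : ℝ, ∀ (W : WeierstrassCurve ℚ) [W.IsElliptic] [W.IsGloballyMinimal]
    [NeZero (W.conductorNorm ℤ)], W.IsSemistable ℤ →
      ((max (|W.c₄| ^ 3) (W.c₆ ^ 2) : ℚ) : ℝ) ≤ C * (W.conductorNorm ℤ : ℝ) ^ σ

/-- `max(|Δ|, |c₄|³) ≤ max(|c₄|³, c₆²)`: from `1728Δ = c₄³ − c₆²` (Mathlib `c_relation`),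
`1728|Δ| ≤ |c₄|³ + c₆² ≤ 2·max`. [folklore] -/
theorem max_Δ_c4_le_naive (W : WeierstrassCurve ℚ) :
    max |W.Δ| (|W.c₄| ^ 3) ≤ max (|W.c₄| ^ 3) (W.c₆ ^ 2) := by
  have hrel : (1728 : ℚ) * W.Δ = W.c₄ ^ 3 - W.c₆ ^ 2 := W.c_relation
  have h3 : |W.c₄| ^ 3 = |W.c₄ ^ 3| := (abs_pow W.c₄ 3).symm
  refine max_le ?_ (le_max_left _ _)
  have hc6 : (0 : ℚ) ≤ W.c₆ ^ 2 := sq_nonneg _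
  have hA : |W.c₄ ^ 3| ≤ max (|W.c₄| ^ 3) (W.c₆ ^ 2) := h3 ▸ le_max_left _ _
  have hB : W.c₆ ^ 2 ≤ max (|W.c₄| ^ 3) (W.c₆ ^ 2) := le_max_right _ _
  have habs : (1728 : ℚ) * |W.Δ| ≤ |W.c₄ ^ 3| + W.c₆ ^ 2 := by
    rw [← abs_of_pos (by norm_num : (0 : ℚ) < 1728), ← abs_mul, hrel]
    calc |W.c₄ ^ 3 - W.c₆ ^ 2| ≤ |W.c₄ ^ 3| + |W.c₆ ^ 2| := abs_sub _ _
      _ = |W.c₄ ^ 3| + W.c₆ ^ 2 := by rw [abs_of_nonneg hc6]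
  nlinarith [abs_nonneg W.Δ]

/-- `max(|c₄|³, c₆²) ≤ 1729 · max(|Δ|, |c₄|³)`: `c₆² = c₄³ − 1728Δ`. [folklore] -/
theorem naive_le_max_Δ_c4 (W : WeierstrassCurve ℚ) :
    max (|W.c₄| ^ 3) (W.c₆ ^ 2) ≤ 1729 * max |W.Δ| (|W.c₄| ^ 3) := by
  have hrel : (1728 : ℚ) * W.Δ = W.c₄ ^ 3 - W.c₆ ^ 2 := W.c_relation
  have h3 : |W.c₄| ^ 3 = |W.c₄ ^ 3| := (abs_pow W.c₄ 3).symm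
  have hM0 : (0 : ℚ) ≤ max |W.Δ| (|W.c₄| ^ 3) := le_trans (abs_nonneg _) (le_max_left _ _)
  have hA : |W.c₄ ^ 3| ≤ max |W.Δ| (|W.c₄| ^ 3) := by rw [← h3]; exact le_max_right _ _
  have hD : |W.Δ| ≤ max |W.Δ| (|W.c₄| ^ 3) := le_max_left _ _
  refine max_le ?_ ?_
  · exact le_trans (le_max_right _ _) (le_mul_of_one_le_left hM0 (by norm_num))
  · have h6 : W.c₆ ^ 2 = W.c₄ ^ 3 - 1728 * W.Δ := by linarith
    rw [h6]
    linarith [le_abs_self (W.c₄ ^ 3), neg_le_abs W.Δ]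

/-- **`H` is equivalent to its naive-height form** (constants `C ↦ C` resp. `1729·C`). [folklore] -/
theorem H_iff_naive : H ↔ HNaive := by
  constructor
  · rintro ⟨σ, C, h⟩
    refine ⟨σ, 1729 * C, fun W _ _ _ hW ↦ ?_⟩
    have h1 := h W hW
    have h2 : ((max (|W.c₄| ^ 3) (W.c₆ ^ 2) : ℚ) : ℝ) ≤ ((1729 * max |W.Δ| (|W.c₄| ^ 3) : ℚ) : ℝ) :=
      Rat.cast_le.mpr (naive_le_max_Δ_c4 W)
    have h3 := mul_le_mul_of_nonneg_left h1 (by norm_num : (0 : ℝ) ≤ 1729)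
    push_cast at h2 h3 ⊢
    linarith
  · rintro ⟨σ, C, h⟩
    refine ⟨σ, C, fun W _ _ _ hW ↦ le_trans ?_ (h W hW)⟩
    exact_mod_cast max_Δ_c4_le_naive W

/-- **The naive-height form has the same floor: no `σ ≤ 6` slice holds** (Masser's semistable curves,
through the landed `not_polyHeightAt_of_le_six` and `max(|Δ|,|c₄|³) ≤ max(|c₄|³, c₆²)`).
[cite: Masser1990, Theorem and Lemma 1] -/
theorem not_naiveHeightAt_of_le_six {σ : ℝ} (hσ : σ ≤ 6) :
    ¬ ∃ C : ℝ, ∀ (W : WeierstrassCurve ℚ) [W.IsElliptic] [W.IsGloballyMinimal]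
      [NeZero (W.conductorNorm ℤ)], W.IsSemistable ℤ →
        ((max (|W.c₄| ^ 3) (W.c₆ ^ 2) : ℚ) : ℝ) ≤ C * (W.conductorNorm ℤ : ℝ) ^ σ := by
  rintro ⟨C, h⟩
  refine Summit.ABC.ABC.Theorems.SharpDegreeOfPolyHeight.Negative.not_polyHeightAt_of_le_six hσ
    ⟨C, fun W _ _ _ hW ↦ le_trans ?_ (h W hW)⟩
  exact_mod_cast max_Δ_c4_le_naive W

/-- **Floor of the Δ-half** (landed `not_polySzpiroΔAt_of_le_six`, p121766, re-exported): for
`σ ≤ 6` there is no `C` with `|Δ_W| ≤ C·N_W^σ` on all semistable global minimal elliptic `W/ℚ`.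
[cite: Masser1990, Theorem and Lemma 1] -/
theorem not_polySzpiroΔAt_of_le_six {σ : ℝ} (hσ : σ ≤ 6) :
    ¬ ∃ C : ℝ, ∀ (W : WeierstrassCurve ℚ) [W.IsElliptic] [W.IsGloballyMinimal]
      [NeZero (W.conductorNorm ℤ)], W.IsSemistable ℤ →
        ((|W.Δ| : ℚ) : ℝ) ≤ C * (W.conductorNorm ℤ : ℝ) ^ σ :=
  Summit.ABC.ABC.Theorems.PolyHeightOfBoundedPrimes.Negative.not_polySzpiroΔAt_of_le_six hσ

/-- **The split is exact** (landed `split_of_polyHeight`, p122124, re-exported): `H` implies the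
Δ-half with the same `(σ, C)` and the Hall half with `(max σ 0, max C 0)`, because
`1 ≤ N_W ≤ |Δ_W|` on a global minimal model. Together with the card's `polyHeight_of_split` the
consequent of B' is EQUIVALENT to (Δ-half ∧ Hall half), so the three floors above bind every
split-organised proof. [folklore] -/
theorem split_of_H (hH : H) :
    (∃ σ C : ℝ, ∀ (W : WeierstrassCurve ℚ) [W.IsElliptic] [W.IsGloballyMinimal]
      [NeZero (W.conductorNorm ℤ)], W.IsSemistable ℤ →
        ((|W.Δ| : ℚ) : ℝ) ≤ C * (W.conductorNorm ℤ : ℝ) ^ σ) ∧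
    (∃ σ C : ℝ, 0 ≤ σ ∧ ∀ (W : WeierstrassCurve ℚ) [W.IsElliptic] [W.IsGloballyMinimal]
      [NeZero (W.conductorNorm ℤ)], W.IsSemistable ℤ →
        ((|W.c₄| ^ 3 : ℚ) : ℝ) ≤ C * ((|W.Δ| : ℚ) : ℝ) ^ σ) :=
  Summit.ABC.ABC.Theorems.PolyHeightOfBoundedPrimes.Negative.split_of_polyHeight hH

/-! ## §4 Natural strengthenings: see the index (all landed or §2e) -/

/-- For `σ ≤ 6` the fixed-exponent item is `¬A` (landed, p117988). Re-export.
[cite: Masser1990, Theorem and Lemma 1] -/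
theorem fixedExponent_iff_not_A {σ : ℝ} (hσ : σ ≤ 6) :
    (DegreePrimesPolyBounded → ∃ C : ℝ, ∀ (W : WeierstrassCurve ℚ) [W.IsElliptic]
      [W.IsGloballyMinimal] [NeZero (W.conductorNorm ℤ)], W.IsSemistable ℤ →
      ((max |W.Δ| (|W.c₄| ^ 3) : ℚ) : ℝ) ≤ C * (W.conductorNorm ℤ : ℝ) ^ σ) ↔
      ¬ DegreePrimesPolyBounded :=
  Summit.ABC.ABC.Theorems.PolyHeightOfBoundedPrimes.Negative.polyHeightOfBoundedPrimes_exp_le_six_iff_not_degreePrimesPolyBounded hσ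

/-! ## §7 The archimedean component (landed p121348) -/

/-- **The `c₄`-component alone has floor `6`** (landed `not_polyC4At_of_lt_six`, re-exported): for
`σ < 6` there is no `C` with `|c₄(W)|³ ≤ C·N_W^σ` on all semistable global minimal elliptic `W/ℚ`.
Witness: Masser-type Frey pairs, `Δ > 0`, `|c₄|³ ≥ c₄³ = c₆² + 1728Δ ≥ 1728|Δ_min| ≥ N⁶`.
Open residue (not sorried, just not reached): `σ = 6` with an arbitrary constant.
[cite: Masser1990, Lemma 1] -/
theorem not_polyC4At_of_lt_six {σ : ℝ} (hσ : σ < 6) :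
    ¬ ∃ C : ℝ, ∀ (W : WeierstrassCurve ℚ) [W.IsElliptic] [W.IsGloballyMinimal]
      [NeZero (W.conductorNorm ℤ)], W.IsSemistable ℤ →
        ((|W.c₄| ^ 3 : ℚ) : ℝ) ≤ C * (W.conductorNorm ℤ : ℝ) ^ σ :=
  Summit.ABC.ABC.Theorems.PolyHeightOfBoundedPrimes.Negative.not_polyC4At_of_lt_six hσ

/-- Any exponent of an "archimedean half" `|c₄|³ ≤ C·N^σ` is `≥ 6` (landed `six_le_of_polyC4At`).
[cite: Masser1990, Lemma 1] -/
theorem six_le_of_polyC4At {σ C : ℝ}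
    (h : ∀ (W : WeierstrassCurve ℚ) [W.IsElliptic] [W.IsGloballyMinimal]
      [NeZero (W.conductorNorm ℤ)], W.IsSemistable ℤ →
        ((|W.c₄| ^ 3 : ℚ) : ℝ) ≤ C * (W.conductorNorm ℤ : ℝ) ^ σ) : 6 ≤ σ :=
  Summit.ABC.ABC.Theorems.PolyHeightOfBoundedPrimes.Negative.six_le_of_polyC4At h

/-! ## §7b The Hall half (landed p121660) -/

/-- **The Hall half has floor `3/2`** (landed `not_polyHallAt_of_lt_three_halves`, re-exported):
for `0 ≤ σ' < 3/2` there is no `C` with `|c₄(W)|³ ≤ C·|Δ_W|^{σ'}` on all semistable global minimal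
elliptic `W/ℚ` (Frey family `(a, b) = (−1, 32k)`). [cite: Frey1986] -/
theorem not_polyHallAt_of_lt_three_halves {σ : ℝ} (hσ0 : 0 ≤ σ) (hσ : σ < 3 / 2) :
    ¬ ∃ C : ℝ, ∀ (W : WeierstrassCurve ℚ) [W.IsElliptic] [W.IsGloballyMinimal]
      [NeZero (W.conductorNorm ℤ)], W.IsSemistable ℤ →
        ((|W.c₄| ^ 3 : ℚ) : ℝ) ≤ C * ((|W.Δ| : ℚ) : ℝ) ^ σ :=
  Summit.ABC.ABC.Theorems.PolyHeightOfBoundedPrimes.Negative.not_polyHallAt_of_lt_three_halves hσ0 hσ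

/-- Any exponent of the card's `PolyHallΔ` is `≥ 3/2` (landed `three_halves_le_of_polyHallAt`).
[cite: Frey1986] -/
theorem three_halves_le_of_polyHallAt {σ C : ℝ} (hσ0 : 0 ≤ σ)
    (h : ∀ (W : WeierstrassCurve ℚ) [W.IsElliptic] [W.IsGloballyMinimal]
      [NeZero (W.conductorNorm ℤ)], W.IsSemistable ℤ →
        ((|W.c₄| ^ 3 : ℚ) : ℝ) ≤ C * ((|W.Δ| : ℚ) : ℝ) ^ σ) : 3 / 2 ≤ σ :=
  Summit.ABC.ABC.Theorems.PolyHeightOfBoundedPrimes.Negative.three_halves_le_of_polyHallAt hσ0 h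

end Summit.ABC.ABC.Cruxes.PolyHeightOfBoundedPrimes.Disproof

end
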